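import Mathlib
import HarnessLib
import Summits.HubbardSuperconductivity.HubbardSuperconductivity.Theorems.KLProgrammeKLRegimeTwoPointAssemblyDiag
import Summits.HubbardSuperconductivity.HubbardSuperconductivity.Theorems.KLProgrammeKLRegimeWickOrderedStep

/-!
# Route `KLProgramme` — ENGINE child (E2-v9): the Wick LINES of the model — contraction tables of the cutoff covariances
# (E2-WICK-ROADMAP §5 (iii-c), step 1; cell gate-hubbard-kl, seat p1 g8)

The Feynman rules of the Wick-ordered step (`constPart_bubble_colouring_*`, p487434) read lines through the two-point function
`contr E X Y = ½(E(Y,X) − E(X,Y))` of the covariance `E` carried by the line: the slice `g_n = klSliceCov … n`, the soft covariance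
`D_n = klSoftCov … n`, the hard one `klHardCov … n` — all of the form `weight × C^K` (`hubbardCovAboveCT = ½(χ_Λ(k_X)+χ_Λ(k_Y))·C^K`).
The full-covariance table is r2d-p2's (`contr_minus_plus`: `A_K(ψ̂⁻_{kσ}, ψ̂⁺_{kσ}) = βL²·ĝ_K(k)`, `contr_plus_minus`, `contr_minus_eq_zero`,
`contr_plus_eq_zero`, module `…TwoPointAssemblyDiag`).  This file transports it through the cutoff weights: a symmetric entrywise weight
passes `contr` (`contr_of_symm_weight`), so `contr (C^K_{>Λ}) X Y = ½(χ_Λ(k_X)+χ_Λ(k_Y))·contr C^K X Y` (`contr_covAboveCT`); on the reciprocal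
pair the weight is `χ_Λ(k)` (`contr_covAboveCT_minus_plus/_plus_minus`), off it the contraction vanishes (`…_minus_eq_zero/_plus_eq_zero`); the
slice and soft tables follow by additivity (`contr_sub`; `contr_klSliceCov_minus_plus`, `contr_klSoftCov_minus_plus`, `contr_klHardCov_minus_plus` and
the vanishing off the reciprocal pair).  Model bookkeeping at seed `h = 0`; proved; no definitions.
-/

noncomputable section

namespace Summit.HubbardSuperconductivity.HubbardSuperconductivity.Theorems.KLRegimeWick

set_option linter.dupNamespace false -- summit = problem name (single-conjunct summit), D-0017

open Literature.MathematicalPhysics.QuantumLattice GrassmannAlgebra Finset Matrix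
open Literature.Probability.LatticeModels
open Summit.HubbardSuperconductivity.HubbardSuperconductivity.Theorems.TwoPointAssembly
open Summit.HubbardSuperconductivity.HubbardSuperconductivity.Theorems.KLProgrammeLegKernels
open Summit.HubbardSuperconductivity.HubbardSuperconductivity.Theorems.KLRegimeSplit

/-! ## §1 Generic: symmetric weights pass the contraction; additivity -/

/-- A symmetric entrywise weight passes `contr`: `contr (s ⊙ C) X Y = s X Y · contr C X Y`. -/
theorem contr_of_symm_weight {Γ' : Type*} (s C : Matrix Γ' Γ' ℂ) (hs : ∀ X Y, s X Y = s Y X) (X Y : Γ') :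
    contr ℂ (Matrix.of fun X Y => s X Y * C X Y) X Y = s X Y * contr ℂ C X Y := by
  simp only [contr_apply, Matrix.of_apply, hs Y X]
  ring

/-- `contr` is additive: `contr (A − B) = contr A − contr B` entrywise. -/
theorem contr_sub {Γ' : Type*} (A B : Matrix Γ' Γ' ℂ) (X Y : Γ') : contr ℂ (A - B) X Y = contr ℂ A X Y - contr ℂ B X Y := by
  simp only [contr_apply, Matrix.sub_apply]
  ring

/-! ## §2 The cutoff covariances `C^K_{>Λ}` -/

variable {L M : ℕ} [NeZero L]

omit [NeZero L] in
/-- **`contr (C^K_{>Λ}) X Y = ½(χ_Λ(k_X)+χ_Λ(k_Y)) · contr C^K X Y`.** -/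
theorem contr_covAboveCT (β μ : ℝ) (K : TrigPolyC4v) (Λ : ℝ) (X Y : HubbardFieldIdx L M) :
    contr ℂ (hubbardCovAboveCT L M β μ 0 K Λ) X Y =
      (((hubbardCutoffWeightCT L M β μ K Λ (momentumOf L M X) + hubbardCutoffWeightCT L M β μ K Λ (momentumOf L M Y)) / 2 : ℝ) : ℂ) *
        contr ℂ (hubbardCovarianceCT L M β μ 0 K) X Y := by
  unfold hubbardCovAboveCT
  exact contr_of_symm_weight _ _ (fun X Y => by rw [add_comm]) X Y

/-- On the reciprocal pair `(ψ̂⁻_{kσ}, ψ̂⁺_{kσ})`: `contr (C^K_{>Λ}) = χ_Λ(k) · βL² · ĝ_K(k)`. -/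
theorem contr_covAboveCT_minus_plus {β : ℝ} (hβ : β ≠ 0) (μ : ℝ) (K : TrigPolyC4v) (Λ : ℝ) (k : FreqMomentum L M) (σ : Fin 2) :
    contr ℂ (hubbardCovAboveCT L M β μ 0 K Λ) ((k, σ), 1) ((k, σ), 0) =
      (hubbardCutoffWeightCT L M β μ K Λ k : ℂ) * (((β * (L : ℝ) ^ 2 : ℝ) : ℂ) * propCT L M β μ K k) := by
  rw [contr_covAboveCT, contr_minus_plus hβ]
  simp only [momentumOf]
  rw [show ∀ a : ℝ, (a + a) / 2 = a from fun a => by ring]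

/-- On `(ψ̂⁺_{kσ}, ψ̂⁻_{kσ})`: minus the same. -/
theorem contr_covAboveCT_plus_minus {β : ℝ} (hβ : β ≠ 0) (μ : ℝ) (K : TrigPolyC4v) (Λ : ℝ) (k : FreqMomentum L M) (σ : Fin 2) :
    contr ℂ (hubbardCovAboveCT L M β μ 0 K Λ) ((k, σ), 0) ((k, σ), 1) =
      -((hubbardCutoffWeightCT L M β μ K Λ k : ℂ) * (((β * (L : ℝ) ^ 2 : ℝ) : ℂ) * propCT L M β μ K k)) := by
  rw [contr_swap, contr_covAboveCT_minus_plus hβ]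

/-- Off the reciprocal pair a `ψ̂⁻` line of `C^K_{>Λ}` vanishes. -/
theorem contr_covAboveCT_minus_eq_zero (β μ : ℝ) (K : TrigPolyC4v) (Λ : ℝ) (k : FreqMomentum L M) (σ : Fin 2) {Z : HubbardFieldIdx L M}
    (hZ : Z ≠ ((k, σ), 0)) : contr ℂ (hubbardCovAboveCT L M β μ 0 K Λ) ((k, σ), 1) Z = 0 := by
  rw [contr_covAboveCT, contr_minus_eq_zero β μ K k σ hZ, mul_zero]

/-- Off the reciprocal pair a `ψ̂⁺` line of `C^K_{>Λ}` vanishes. -/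
theorem contr_covAboveCT_plus_eq_zero (β μ : ℝ) (K : TrigPolyC4v) (Λ : ℝ) (k : FreqMomentum L M) (σ : Fin 2) {Y : HubbardFieldIdx L M}
    (hY : Y ≠ ((k, σ), 1)) : contr ℂ (hubbardCovAboveCT L M β μ 0 K Λ) ((k, σ), 0) Y = 0 := by
  rw [contr_covAboveCT, contr_plus_eq_zero β μ K k σ hY, mul_zero]

/-! ## §3 The lines of the Wick-ordered step: hard `klHardCov`, slice `klSliceCov`, soft `klSoftCov` -/

/-- **Hard line** `C^K_{>Λ_n}` on the reciprocal pair: `χ_{Λ_n}(k) · βL² ĝ_K(k)`. -/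
theorem contr_klHardCov_minus_plus {β : ℝ} (hβ : β ≠ 0) (μ : ℝ) (K : TrigPolyC4v) (n : ℕ) (k : FreqMomentum L M) (σ : Fin 2) :
    contr ℂ (klHardCov L M β μ K n) ((k, σ), 1) ((k, σ), 0) =
      (hubbardCutoffWeightCT L M β μ K (klScale klE0 n) k : ℂ) * (((β * (L : ℝ) ^ 2 : ℝ) : ℂ) * propCT L M β μ K k) :=
  contr_covAboveCT_minus_plus hβ μ K _ k σ

/-- **Slice line** `g_n = C^K_{>Λ_n} − C^K_{>Λ_{n−1}}` on the reciprocal pair: `(χ_{Λ_n}(k) − χ_{Λ_{n−1}}(k)) · βL² ĝ_K(k)`. -/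
theorem contr_klSliceCov_minus_plus {β : ℝ} (hβ : β ≠ 0) (μ : ℝ) (K : TrigPolyC4v) (n : ℕ) (k : FreqMomentum L M) (σ : Fin 2) :
    contr ℂ (klSliceCov L M β μ K n) ((k, σ), 1) ((k, σ), 0) =
      ((hubbardCutoffWeightCT L M β μ K (klScale klE0 n) k - hubbardCutoffWeightCT L M β μ K (klScale klE0 (n - 1)) k : ℝ) : ℂ) *
        (((β * (L : ℝ) ^ 2 : ℝ) : ℂ) * propCT L M β μ K k) := by
  rw [klSliceCov, hubbardCovSliceCT, contr_sub, contr_covAboveCT_minus_plus hβ, contr_covAboveCT_minus_plus hβ, Complex.ofReal_sub]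
  ring

/-- **Soft line** `D_n = C^K − C^K_{>Λ_n}` on the reciprocal pair: `(1 − χ_{Λ_n}(k)) · βL² ĝ_K(k)`. -/
theorem contr_klSoftCov_minus_plus {β : ℝ} (hβ : β ≠ 0) (μ : ℝ) (K : TrigPolyC4v) (n : ℕ) (k : FreqMomentum L M) (σ : Fin 2) :
    contr ℂ (klSoftCov L M β μ K n) ((k, σ), 1) ((k, σ), 0) =
      ((1 - hubbardCutoffWeightCT L M β μ K (klScale klE0 n) k : ℝ) : ℂ) * (((β * (L : ℝ) ^ 2 : ℝ) : ℂ) * propCT L M β μ K k) := by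
  rw [klSoftCov, hubbardCovBelowCT, contr_sub, contr_minus_plus hβ, contr_covAboveCT_minus_plus hβ, Complex.ofReal_sub, Complex.ofReal_one]
  ring

omit [NeZero L] in
/-- The three lines with the charges swapped: minus the same (antisymmetry of `contr`). -/
theorem contr_kl_plus_minus {β : ℝ} (μ : ℝ) (K : TrigPolyC4v) (n : ℕ) (k : FreqMomentum L M) (σ : Fin 2) :
    contr ℂ (klHardCov L M β μ K n) ((k, σ), 0) ((k, σ), 1) = -contr ℂ (klHardCov L M β μ K n) ((k, σ), 1) ((k, σ), 0) ∧
    contr ℂ (klSliceCov L M β μ K n) ((k, σ), 0) ((k, σ), 1) = -contr ℂ (klSliceCov L M β μ K n) ((k, σ), 1) ((k, σ), 0) ∧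
    contr ℂ (klSoftCov L M β μ K n) ((k, σ), 0) ((k, σ), 1) = -contr ℂ (klSoftCov L M β μ K n) ((k, σ), 1) ((k, σ), 0) :=
  ⟨contr_swap _ _ _ _, contr_swap _ _ _ _, contr_swap _ _ _ _⟩

/-- **Off the reciprocal pair every line of the step vanishes** (`ψ̂⁻` end). -/
theorem contr_kl_minus_eq_zero (β μ : ℝ) (K : TrigPolyC4v) (n : ℕ) (k : FreqMomentum L M) (σ : Fin 2) {Z : HubbardFieldIdx L M}
    (hZ : Z ≠ ((k, σ), 0)) :
    contr ℂ (klHardCov L M β μ K n) ((k, σ), 1) Z = 0 ∧ contr ℂ (klSliceCov L M β μ K n) ((k, σ), 1) Z = 0 ∧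
      contr ℂ (klSoftCov L M β μ K n) ((k, σ), 1) Z = 0 := by
  refine ⟨contr_covAboveCT_minus_eq_zero β μ K _ k σ hZ, ?_, ?_⟩
  · rw [klSliceCov, hubbardCovSliceCT, contr_sub, contr_covAboveCT_minus_eq_zero β μ K _ k σ hZ,
      contr_covAboveCT_minus_eq_zero β μ K _ k σ hZ, sub_zero]
  · rw [klSoftCov, hubbardCovBelowCT, contr_sub, contr_minus_eq_zero β μ K k σ hZ, contr_covAboveCT_minus_eq_zero β μ K _ k σ hZ, sub_zero]

/-- **Off the reciprocal pair every line of the step vanishes** (`ψ̂⁺` end). -/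
theorem contr_kl_plus_eq_zero (β μ : ℝ) (K : TrigPolyC4v) (n : ℕ) (k : FreqMomentum L M) (σ : Fin 2) {Y : HubbardFieldIdx L M}
    (hY : Y ≠ ((k, σ), 1)) :
    contr ℂ (klHardCov L M β μ K n) ((k, σ), 0) Y = 0 ∧ contr ℂ (klSliceCov L M β μ K n) ((k, σ), 0) Y = 0 ∧
      contr ℂ (klSoftCov L M β μ K n) ((k, σ), 0) Y = 0 := by
  refine ⟨contr_covAboveCT_plus_eq_zero β μ K _ k σ hY, ?_, ?_⟩
  · rw [klSliceCov, hubbardCovSliceCT, contr_sub, contr_covAboveCT_plus_eq_zero β μ K _ k σ hY,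
      contr_covAboveCT_plus_eq_zero β μ K _ k σ hY, sub_zero]
  · rw [klSoftCov, hubbardCovBelowCT, contr_sub, contr_plus_eq_zero β μ K k σ hY, contr_covAboveCT_plus_eq_zero β μ K _ k σ hY, sub_zero]

end Summit.HubbardSuperconductivity.HubbardSuperconductivity.Theorems.KLRegimeWick

end
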